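import Literature.NumberTheory.EllipticCurves.Kato2004.EllipticUnitTatePairingValuesKOfGross
import Literature.NumberTheory.LFunctions.GrossencharakterWeightOneNorm
import Literature.NumberTheory.QuadraticFields.KroneckerSplitting
import Literature.NumberTheory.Automorphic.GaloisActionPlaces
import Summits.BirchSwinnertonDyer.BirchSwinnertonDyer.Theorems.SignedLowerHalvesSmallImageLowerHalfBothSignsLambdaLowerThreeNsThetaPartnerPlaces
import Mathlib.NumberTheory.LegendreSymbol.JacobiSymbol
import HarnessLib

/-!
# F1 → THE MATCH: CM-reality `ψ(c • w) = ψ̄(w)` of the crux's Grössencharakter FROM THE PREFIX ALONE (no UNIQ, no density)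

Summit `BirchSwinnertonDyer`, crux `SmallImageLowerHalfBothSigns` (stmt-23599), line `rtt_w3`, THE MATCH (road input (P2) of «ROAD-𝔪»).
Namespace `…Theorems.SmallImageRttF1Bridge`. THEOREMS ONLY.

For the crux prefix's Grössencharakter `ψ mod 𝔪` of the imaginary quadratic `K` (type `(1,0)` at `σK`, trivial Nebentypus
`hψpow : ψ((n)) = (d_K/n)·n` for odd `n ⊥ d_K·N𝔪`) and the nontrivial automorphism `c` of `K`, CM-reality holds at EVERY prime `w` over a rational
prime `ℓ ∤ d_K·N𝔪` — the primes that occur in the depleted sums of THE MATCH once the frame absorbs `𝔪` (`…CharRoadFrame6`): the primes over `ℓ`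
are `{w, c • w}` (`eq_or_eq_smul_of_natCast_mem`, Galois transitivity in the quadratic field); if `c • w = w` then `ψ(w) = ψ((ℓ))` is REAL
(`= (d_K/ℓ)·ℓ`, resp. `= ±2` at `ℓ = 2` by the parity trick `ψ((2))/2 = ψ((n))/n` for the odd `n = D² + 2 ≡ 2 (mod 𝔪)`); if `c • w ≠ w` then
`ψ(w)·ψ(c • w) = ψ((ℓ)) = +ℓ` (`(d_K/ℓ) = 1` for split `ℓ`, tree `natCard_placesOver_eq_two_iff_jacobiSym`; at `ℓ = 2`: `d_K ≡ 1 (8)` by the tree's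
decomposition law `Quadratic.ncard_primesOver_two_eq_two_iff` and the Jacobi computation `jacobiSym_eq_one_of_mod_eight`), while `|ψ(w)|² = N w =
|ψ(c • w)|²` (tree `sq_norm_idealPow_eq_absNorm`), whence `ψ(c • w) = ℓ/ψ(w) = ψ̄(w)`.

* ★★ `apply_smul_eq_conj_of_prefix` — `ψ (c • w) = conj (ψ w)` for every `w` over `ℓ ∤ d_K·N𝔪`. With `supp(d_K·𝔪) ⊆ supp(p𝔣)` this IS the premise
  `hψc` of `prop159_values_inert_hV_frame_of_isGrossencharakter₂` on the primes the reindexing uses; it replaces UNIQ in «ROAD-𝔪» (P2).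

References: [NeukirchANT1999] VII §6 (6.1); [Marcus2018] Ch. 3 Thm. 25; [IrelandRosen1990] Prop. 5.2.2, 13.1.4; [SilvermanATAEC1994] II Ex. 2.30.
-/

-- the Theorems namespace of this sub repeats the summit name by design (D-0017 nested layout)
set_option linter.dupNamespace false

noncomputable section

open scoped Classical NumberField ComplexConjugate Pointwise NumberTheorySymbols
open NumberField IsDedekindDomain Field

namespace Summit.BirchSwinnertonDyer.BirchSwinnertonDyer.Theorems.SmallImageRttF1Bridge

open Literature.NumberTheory.EllipticCurves Literature.NumberTheory.GaloisRepresentations Literature.NumberTheory.LFunctions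
  Literature.NumberTheory.Automorphic Literature.NumberTheory.EllipticCurves.Kato2004.CM Rat.HeightOneSpectrum
  Summit.BirchSwinnertonDyer.BirchSwinnertonDyer.Theorems.SmallImageLambdaLowerThreeNsThetaPartner

/-! ## §1. A Jacobi-symbol computation: `(d / D²+2) = 1` for `d ≡ 1 (8)`, `d < 0`, `d ∣ D` -/

/-- **`J(d | n) = 1` for `d < 0`, `d ≡ 1 (mod 8)`, `n ≡ 3 (mod 8)`, `n ≡ 2 (mod d)`**: `J(d|n) = χ₄(n)·J(|d| | n) = χ₄(n)·(−J(n | |d|))`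
(`|d| ≡ n ≡ 3 mod 4`) `= J(2 | |d|) = χ₈(|d|) = χ₈(7) = 1`. [cite: IrelandRosen1990, Ch. 5 §2 Prop. 5.2.2 (Jacobi reciprocity)] -/
theorem jacobiSym_eq_one_of_mod_eight {d : ℤ} {n : ℕ} (hd8 : d % 8 = 1) (hd : d < 0) (hn8 : n % 8 = 3)
    (hdn : d ∣ (n : ℤ) - 2) : jacobiSym d n = 1 := by
  set m : ℕ := d.natAbs with hm
  have hmd : (m : ℤ) = -d := by rw [hm, Int.natCast_natAbs, abs_of_neg hd]
  have hm8 : m % 8 = 7 := by omega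
  have hm4 : m % 4 = 3 := by omega
  have hn4 : n % 4 = 3 := by omega
  have hmodd : Odd m := Nat.odd_iff.mpr (by omega)
  have hnodd : Odd n := Nat.odd_iff.mpr (by omega)
  have hdm : d = -(m : ℤ) := by omega
  rw [hdm, jacobiSym.neg _ hnodd, ZMod.χ₄_nat_three_mod_four hn4, jacobiSym.quadratic_reciprocity_three_mod_four hm4 hn4,
    jacobiSym.mod_left (n : ℤ) m]
  have hmod : (n : ℤ) % m = 2 := by
    have hmdvd : (m : ℤ) ∣ (n : ℤ) - 2 := by rw [hmd]; exact (neg_dvd).mpr hdn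
    obtain ⟨k, hk⟩ := hmdvd
    rw [show (n : ℤ) = 2 + m * k by linarith, Int.add_mul_emod_self_left]
    exact Int.emod_eq_of_lt (by norm_num) (by omega)
  have hm2 : ¬ (m % 2 = 0) := by omega
  rw [hmod, jacobiSym.at_two hmodd, ZMod.χ₈_nat_eq_if_mod_eight, hm8]
  simp [hm2]

/-! ## §2. Algebra: `a·b = ℓ > 0` and `|a| = |b|` force `b = ā` -/

/-- If `a·b` is a positive real `ℓ` and `|a|² = |b|²`, then `b = \overline{a}` (`|a|⁴ = ℓ²`, so `a ā = ℓ = a b`). [cite: SilvermanATAEC1994, Ch. II Ex. 2.30] -/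
theorem eq_conj_of_mul_eq_of_norm_sq_eq {a b : ℂ} {ℓ : ℝ} (hℓ : 0 < ℓ) (hab : a * b = ℓ) (hn : ‖a‖ ^ 2 = ‖b‖ ^ 2) : b = conj a := by
  have ha2 : ‖a‖ ^ 2 = ℓ := by
    have h1 : ‖a‖ * ‖b‖ = ℓ := by rw [← norm_mul, hab, Complex.norm_real, Real.norm_of_nonneg hℓ.le]
    have hb : ‖b‖ = ‖a‖ := by
      have := (sq_eq_sq₀ (norm_nonneg a) (norm_nonneg b)).mp hn
      exact this.symm
    rw [hb] at h1
    rw [sq, h1]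
  have ha0 : a ≠ 0 := by
    rintro rfl
    rw [norm_zero, zero_pow two_ne_zero] at ha2
    exact hℓ.ne' ha2.symm
  have hconj : a * conj a = ℓ := by
    rw [Complex.mul_conj, Complex.normSq_eq_norm_sq, ha2]
  exact mul_left_cancel₀ ha0 (hab.trans hconj.symm)

/-! ## §3. The primes of a quadratic field over an unramified rational prime: `{w, c • w}` -/

section Places

variable {K : Type} [Field K] [NumberField K]

/-- In a quadratic field every automorphism is `1` or the given nontrivial `c`. [cite: Marcus2018, Ch. 2 (quadratic fields)] -/
theorem algEquiv_eq_one_or_eq (hK2 : Module.finrank ℚ K = 2) (c : K ≃ₐ[ℚ] K) (hc : c ≠ 1) (σ : K ≃ₐ[ℚ] K) : σ = 1 ∨ σ = c := by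
  haveI : Algebra.IsQuadraticExtension ℚ K := ⟨hK2⟩
  have hcard : Fintype.card (K ≃ₐ[ℚ] K) = 2 := by
    rw [← Nat.card_eq_fintype_card]; exact (IsGalois.card_aut_eq_finrank ℚ K).trans hK2
  by_contra h
  push Not at h
  have h3 : 2 < Fintype.card (K ≃ₐ[ℚ] K) := Fintype.two_lt_card_iff.mpr ⟨σ, 1, c, h.1, h.2, hc.symm⟩
  omega

/-- ★ **The primes over an (arbitrary) rational prime `ℓ` in a quadratic field are `w` and `c • w`** (Galois transitivity on the fibre,
`Gal(K/ℚ) = {1, c}`). [cite: Marcus2018, Ch. 3 Thm. 23 and Thm. 25] -/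
theorem eq_or_eq_smul_of_natCast_mem (hK2 : Module.finrank ℚ K = 2) (c : K ≃ₐ[ℚ] K) (hc : c ≠ 1) {ℓ : ℕ} (hℓ : ℓ.Prime)
    {w u : HeightOneSpectrum (𝓞 K)} (hw : (ℓ : 𝓞 K) ∈ w.asIdeal) (hu : (ℓ : 𝓞 K) ∈ u.asIdeal) : u = w ∨ u = c • w := by
  haveI : Algebra.IsQuadraticExtension ℚ K := ⟨hK2⟩
  set v : HeightOneSpectrum (𝓞 ℚ) := (primesEquiv (R := 𝓞 ℚ)).symm ⟨ℓ, hℓ⟩ with hvdef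
  have hv : (primesEquiv v : ℕ) = ℓ := by rw [hvdef, Equiv.apply_symm_apply]
  have hwv : w.under (𝓞 ℚ) = v := (under_eq_iff_natCast_primesEquiv_mem w v).mpr (by rw [hv]; exact hw)
  have huv : u.under (𝓞 ℚ) = v := (under_eq_iff_natCast_primesEquiv_mem u v).mpr (by rw [hv]; exact hu)
  obtain ⟨σ, hσ⟩ := HeightOneSpectrum.exists_algEquiv_smul_eq (F := ℚ) (hwv.trans huv.symm)
  rcases algEquiv_eq_one_or_eq hK2 c hc σ with rfl | rfl
  · left; rw [← hσ, one_smul]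
  · right; exact hσ.symm

/-- The set of primes over `ℓ` is `{w, c • w}`. [cite: Marcus2018, Ch. 3 Thm. 25] -/
theorem setOf_natCast_mem_eq_pair (hK2 : Module.finrank ℚ K = 2) (c : K ≃ₐ[ℚ] K) (hc : c ≠ 1) {ℓ : ℕ} (hℓ : ℓ.Prime)
    {w : HeightOneSpectrum (𝓞 K)} (hw : (ℓ : 𝓞 K) ∈ w.asIdeal) :
    {u : HeightOneSpectrum (𝓞 K) | (ℓ : 𝓞 K) ∈ u.asIdeal} = {w, c • w} := by
  ext u
  simp only [Set.mem_setOf_eq, Set.mem_insert_iff, Set.mem_singleton_iff]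
  refine ⟨fun hu ↦ eq_or_eq_smul_of_natCast_mem hK2 c hc hℓ hw hu, ?_⟩
  rintro (rfl | rfl)
  · exact hw
  · rw [HeightOneSpectrum.smul_asIdeal]
    have h := Ideal.smul_mem_pointwise_smul c _ w.asIdeal hw
    rwa [show c • ((ℓ : ℕ) : 𝓞 K) = (ℓ : 𝓞 K) from map_natCast (MulSemiringAction.toRingHom (K ≃ₐ[ℚ] K) (𝓞 K) c) ℓ] at h

/-- If `c • w ≠ w` there are two places over `ℓ`. [cite: Marcus2018, Ch. 3 Thm. 25] -/
theorem natCard_placesOver_eq_two_of_ne (hK2 : Module.finrank ℚ K = 2) (c : K ≃ₐ[ℚ] K) (hc : c ≠ 1) {ℓ : ℕ}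
    {v : HeightOneSpectrum (𝓞 ℚ)} (hv : (primesEquiv v : ℕ) = ℓ) {w : HeightOneSpectrum (𝓞 K)} (hw : (ℓ : 𝓞 K) ∈ w.asIdeal) (hcw : c • w ≠ w) :
    Nat.card {u : HeightOneSpectrum (𝓞 K) // u.under (𝓞 ℚ) = v} = 2 := by
  have hℓ : ℓ.Prime := hv ▸ (primesEquiv v).2
  have hiff : ∀ u : HeightOneSpectrum (𝓞 K), u.under (𝓞 ℚ) = v ↔ u ∈ {u : HeightOneSpectrum (𝓞 K) | (ℓ : 𝓞 K) ∈ u.asIdeal} := fun u ↦ by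
    rw [under_eq_iff_natCast_primesEquiv_mem u v, hv]; rfl
  rw [Nat.card_congr (Equiv.subtypeEquivRight hiff), Nat.card_coe_set_eq, setOf_natCast_mem_eq_pair hK2 c hc hℓ hw,
    Set.ncard_pair (Ne.symm hcw)]

end Places

/-! ## §4. Weight one: `|ψ(w)|² = N w`, and the values `ψ((ℓ))` -/

section Values

variable {K : Type} [Field K] [NumberField K] [IsTotallyComplex K] (σK : K →+* ℂ) {𝔪 : Ideal (𝓞 K)} {ψ : HeightOneSpectrum (𝓞 K) → ℂ}

/-- The ray condition in the cross-multiplied form `ψ((b))·σK(c) = ψ((c))·σK(b)` used by `sq_norm_idealPow_eq_absNorm`.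
[cite: NeukirchANT1999, Ch. VII §6 Def. (6.1)] -/
theorem idealPow_span_mul_embedding (hψ : IsGrossencharakter 𝔪 (embType σK) (embTypeConj σK) ψ) :
    ∀ b c : 𝓞 K, b ≠ 0 → c ≠ 0 → IsCoprime (Ideal.span {c}) 𝔪 → b - c ∈ 𝔪 →
      idealPow K ψ (Ideal.span {b}) * σK c = idealPow K ψ (Ideal.span {c}) * σK b := by
  intro b c hb hc hcop hbc
  have hc' : σK (c : K) ≠ 0 := by
    rw [map_ne_zero_iff _ σK.injective]; exact_mod_cast hc
  rw [hψ.idealPow_span_eq b c hb hc hcop hbc fun φ ↦ (not_nonempty_ringHom_real_of_isTotallyComplex K φ).elim,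
    prod_embedding_zpow_embType, map_div₀, mul_assoc, div_mul_cancel₀ _ hc']

/-- **`|ψ(w)|² = N w`** for `w ∤ 𝔪` (weight one). [cite: deShalit1987, II.1.1 (p. 32–33)] -/
theorem norm_apply_sq_eq_absNorm (hK2 : Module.finrank ℚ K = 2) (h𝔪 : 𝔪 ≠ ⊥) (hψ : IsGrossencharakter 𝔪 (embType σK) (embTypeConj σK) ψ)
    {w : HeightOneSpectrum (𝓞 K)} (hw : IsCoprime w.asIdeal 𝔪) : ‖ψ w‖ ^ 2 = ((Ideal.absNorm w.asIdeal : ℕ) : ℝ) := by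
  rw [← idealPow_asIdeal ψ w]
  exact sq_norm_idealPow_eq_absNorm hK2 σK h𝔪 hψ.ne_zero (idealPow_span_mul_embedding σK hψ) w.ne_bot hw

omit [IsTotallyComplex K] in
/-- `(N) + 𝔪 = 1` for a natural number `N` prime to `N𝔪`. [cite: NeukirchANT1999, Ch. I §3 (3.3)] -/
theorem isCoprime_span_natCast_of_coprime_absNorm {N : ℕ} (h : N.Coprime (Ideal.absNorm 𝔪)) :
    IsCoprime (Ideal.span {(N : 𝓞 K)}) 𝔪 := by
  rw [Ideal.isCoprime_iff_exists]
  obtain ⟨a, b, hab⟩ := Nat.isCoprime_iff_coprime.mpr h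
  refine ⟨(a : 𝓞 K) * N, Ideal.mul_mem_left _ _ (Ideal.mem_span_singleton_self _), (b : 𝓞 K) * (Ideal.absNorm 𝔪 : 𝓞 K),
    Ideal.mul_mem_left _ _ (Ideal.absNorm_mem 𝔪), ?_⟩
  have := congrArg (Int.cast : ℤ → 𝓞 K) hab
  push_cast at this
  exact this

omit [IsTotallyComplex K] in
/-- A prime containing `ℓ ∤ N𝔪` is prime to `𝔪`. [cite: NeukirchANT1999, Ch. I §3 (3.3)] -/
theorem isCoprime_of_natCast_mem {ℓ : ℕ} (hℓ : ℓ.Prime) (hℓ𝔪 : ¬ ℓ ∣ Ideal.absNorm 𝔪) {w : HeightOneSpectrum (𝓞 K)}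
    (hw : (ℓ : 𝓞 K) ∈ w.asIdeal) : IsCoprime w.asIdeal 𝔪 := by
  have h1 : IsCoprime (Ideal.span {(ℓ : 𝓞 K)}) 𝔪 :=
    isCoprime_span_natCast_of_coprime_absNorm ((Nat.Prime.coprime_iff_not_dvd hℓ).mpr hℓ𝔪)
  have h𝔪w : ¬ 𝔪 ≤ w.asIdeal := fun hle ↦ by
    have : Ideal.span {(ℓ : 𝓞 K)} ⊔ 𝔪 ≤ w.asIdeal := sup_le ((Ideal.span_singleton_le_iff_mem _).mpr hw) hle
    rw [Ideal.isCoprime_iff_sup_eq.mp h1, top_le_iff] at this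
    exact w.isPrime.ne_top this
  rw [Ideal.isCoprime_iff_sup_eq]
  by_contra hne
  exact h𝔪w (by rw [w.isMaximal.eq_of_le hne le_sup_left]; exact le_sup_right)

/-- **`ψ((2)) = 2·(d_K / D²+2)` when `2 ∤ D = |d_K|·N𝔪`** (parity trick: `n = D² + 2` is odd, `⊥ D`, `≡ 2 (mod 𝔪)`, so the ray condition
gives `ψ((2))/2 = ψ((n))/n = (d_K/n)`). [cite: NeukirchANT1999, Ch. VII §6 Def. (6.1)] -/
theorem idealPow_span_two_eq (hψ : IsGrossencharakter 𝔪 (embType σK) (embTypeConj σK) ψ)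
    (hψpow : ∀ n : ℕ, Odd n → n.Coprime ((NumberField.discr K).natAbs * Ideal.absNorm 𝔪) →
      idealPow K ψ (Ideal.span {(n : 𝓞 K)}) = (jacobiSym (NumberField.discr K) n : ℂ) * (n : ℂ) ^ (2 - 1))
    (h2 : ¬ 2 ∣ (NumberField.discr K).natAbs * Ideal.absNorm 𝔪) :
    idealPow K ψ (Ideal.span {(2 : 𝓞 K)}) =
      2 * (jacobiSym (NumberField.discr K) (((NumberField.discr K).natAbs * Ideal.absNorm 𝔪) ^ 2 + 2) : ℂ) := by
  set D : ℕ := (NumberField.discr K).natAbs * Ideal.absNorm 𝔪 with hD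
  set n : ℕ := D ^ 2 + 2 with hn
  have hD2 : D % 2 = 1 := Nat.two_dvd_ne_zero.mp h2
  have hnodd : Odd n := ((Nat.odd_iff.mpr hD2).pow).add_even even_two
  have hncop : n.Coprime D := by
    have hg2 : Nat.gcd n D ∣ 2 := by
      have h1 : Nat.gcd n D ∣ n := Nat.gcd_dvd_left _ _
      have h2' : Nat.gcd n D ∣ D ^ 2 := dvd_pow (Nat.gcd_dvd_right n D) two_ne_zero
      have := Nat.dvd_sub h1 h2'
      rwa [hn, Nat.add_sub_cancel_left] at this
    have hgodd : ¬ 2 ∣ Nat.gcd n D := fun h ↦ h2 (h.trans (Nat.gcd_dvd_right _ _))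
    rcases (Nat.dvd_prime Nat.prime_two).mp hg2 with h | h
    · exact h
    · exfalso; apply hgodd; simp [h]
  have hvaln := hψpow n hnodd hncop
  -- the ray condition between `(n)` and `(2)`
  have hn0 : (n : 𝓞 K) ≠ 0 := by exact_mod_cast (show n ≠ 0 by rw [hn]; positivity)
  have h20 : (2 : 𝓞 K) ≠ 0 := two_ne_zero
  have h2𝔪 : ¬ 2 ∣ Ideal.absNorm 𝔪 := fun h ↦ h2 (h.trans (dvd_mul_left _ _))
  have hcop2 : IsCoprime (Ideal.span {(2 : 𝓞 K)}) 𝔪 := by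
    have h := isCoprime_span_natCast_of_coprime_absNorm (𝔪 := 𝔪) ((Nat.Prime.coprime_iff_not_dvd Nat.prime_two).mpr h2𝔪)
    rwa [Nat.cast_ofNat] at h
  have hDmem : (D : 𝓞 K) ∈ 𝔪 := by
    rw [hD, Nat.cast_mul]; exact Ideal.mul_mem_left _ _ (Ideal.absNorm_mem 𝔪)
  have hsub : (n : 𝓞 K) - 2 ∈ 𝔪 := by
    have : (n : 𝓞 K) - 2 = (D : 𝓞 K) ^ 2 := by rw [hn]; push_cast; ring
    rw [this, sq]; exact Ideal.mul_mem_left _ _ hDmem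
  have hray := hψ.idealPow_span_eq (n : 𝓞 K) 2 hn0 h20 hcop2 hsub fun φ ↦ (not_nonempty_ringHom_real_of_isTotallyComplex K φ).elim
  rw [prod_embedding_zpow_embType] at hray
  have hσ : σK (((n : 𝓞 K) : K) / ((2 : 𝓞 K) : K)) = (n : ℂ) / 2 := by
    have e1 : ((n : 𝓞 K) : K) = (n : K) := by norm_cast
    have e2 : ((2 : 𝓞 K) : K) = (2 : K) := by norm_cast
    rw [e1, e2, map_div₀, map_natCast, map_ofNat]
  rw [hσ, hvaln] at hray
  -- solve for `ψ((2))`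
  have hn0' : (n : ℂ) ≠ 0 := by exact_mod_cast (show n ≠ 0 by rw [hn]; positivity)
  have key : idealPow K ψ (Ideal.span {(2 : 𝓞 K)}) = (jacobiSym (NumberField.discr K) n : ℂ) * (n : ℂ) ^ (2 - 1) / ((n : ℂ) / 2) := by
    rw [hray]; field_simp
  rw [key]; field_simp; ring

end Values

/-! ## §5. CM-reality from the prefix -/

section Main

variable {K : Type} [Field K] [NumberField K] [IsTotallyComplex K]

/-- `D² + 2 ≡ 3 (mod 8)` for odd `D`. [cite: IrelandRosen1990, Ch. 5 §2] -/
theorem sq_add_two_mod_eight {D : ℕ} (hD : D % 2 = 1) : (D ^ 2 + 2) % 8 = 3 := by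
  have h : D % 8 = 1 ∨ D % 8 = 3 ∨ D % 8 = 5 ∨ D % 8 = 7 := by omega
  rcases h with h | h | h | h <;> simp [Nat.add_mod, Nat.pow_mod, h]

set_option maxHeartbeats 800000 in
/-- ★★ **CM-REALITY OF THE CRUX's GRÖSSENCHARAKTER FROM THE PREFIX ALONE.** For the prefix data of S4‴ — `[K:ℚ] = 2` totally complex, `σK`,
`𝔪 ≠ 0`, `ψ` with `IsGrossencharakter 𝔪 (embType σK) (embTypeConj σK) ψ` and the trivial-Nebentypus clause `hψpow` — and the nontrivial
automorphism `c` of `K`: at every prime `w` over a rational prime `ℓ ∤ |d_K|·N𝔪`, `ψ(c • w) = \overline{ψ(w)}`. No uniqueness/density input.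
[cite: NeukirchANT1999, Ch. VII §6 Def. (6.1)] [cite: Marcus2018, Ch. 3 Thm. 25] [cite: SilvermanATAEC1994, Ch. II Ex. 2.30] -/
theorem apply_smul_eq_conj_of_prefix (hK2 : Module.finrank ℚ K = 2) (σK : K →+* ℂ) (c : K ≃ₐ[ℚ] K) (hc : c ≠ 1)
    {𝔪 : Ideal (𝓞 K)} (h𝔪 : 𝔪 ≠ ⊥) {ψ : HeightOneSpectrum (𝓞 K) → ℂ} (hψ : IsGrossencharakter 𝔪 (embType σK) (embTypeConj σK) ψ)
    (hψpow : ∀ n : ℕ, Odd n → n.Coprime ((NumberField.discr K).natAbs * Ideal.absNorm 𝔪) →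
      idealPow K ψ (Ideal.span {(n : 𝓞 K)}) = (jacobiSym (NumberField.discr K) n : ℂ) * (n : ℂ) ^ (2 - 1))
    {ℓ : ℕ} (hℓ : ℓ.Prime) (hℓD : ¬ ℓ ∣ (NumberField.discr K).natAbs * Ideal.absNorm 𝔪)
    {w : HeightOneSpectrum (𝓞 K)} (hℓw : (ℓ : 𝓞 K) ∈ w.asIdeal) :
    ψ (c • w) = conj (ψ w) := by
  have hK : IsImaginaryQuadratic K := ⟨hK2, inferInstance⟩
  set v : HeightOneSpectrum (𝓞 ℚ) := (primesEquiv (R := 𝓞 ℚ)).symm ⟨ℓ, hℓ⟩ with hvdef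
  have hv : (primesEquiv v : ℕ) = ℓ := by rw [hvdef, Equiv.apply_symm_apply]
  have hℓd : ¬ (ℓ : ℤ) ∣ NumberField.discr K := fun h ↦ hℓD ((Int.natCast_dvd.mp h).trans (dvd_mul_right _ _))
  have hℓ𝔪 : ¬ ℓ ∣ Ideal.absNorm 𝔪 := fun h ↦ hℓD (h.trans (dvd_mul_left _ _))
  have hunr := isUnramifiedIn_asIdeal_of_not_dvd_discr (K := K) hv hℓd
  have hprod := idealPow_span_natCast_eq_finprod (K := K) hv hunr ψ
  rw [setOf_natCast_mem_eq_pair hK2 c hc hℓ hℓw] at hprod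
  have hcw_mem : (ℓ : 𝓞 K) ∈ (c • w).asIdeal := by
    have h := setOf_natCast_mem_eq_pair hK2 c hc hℓ hℓw
    have : c • w ∈ ({w, c • w} : Set (HeightOneSpectrum (𝓞 K))) := by simp
    rw [← h] at this
    exact this
  have hwcop : IsCoprime w.asIdeal 𝔪 := isCoprime_of_natCast_mem hℓ hℓ𝔪 hℓw
  have hcwcop : IsCoprime (c • w).asIdeal 𝔪 := isCoprime_of_natCast_mem hℓ hℓ𝔪 hcw_mem
  -- the value `ψ((ℓ))` is a real number `r`, equal to `ℓ` when there are two places over `ℓ`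
  have hodd_val : ℓ ≠ 2 → idealPow K ψ (Ideal.span {(ℓ : 𝓞 K)}) = (jacobiSym (NumberField.discr K) ℓ : ℂ) * ℓ := fun h2 ↦ by
    rw [hψpow ℓ (hℓ.odd_of_ne_two h2) ((Nat.Prime.coprime_iff_not_dvd hℓ).mpr hℓD), pow_one]
  have htwo_val : ℓ = 2 → idealPow K ψ (Ideal.span {(ℓ : 𝓞 K)}) =
      2 * (jacobiSym (NumberField.discr K) (((NumberField.discr K).natAbs * Ideal.absNorm 𝔪) ^ 2 + 2) : ℂ) := by
    rintro rfl
    rw [show ((2 : ℕ) : 𝓞 K) = 2 from Nat.cast_ofNat, idealPow_span_two_eq σK hψ hψpow hℓD]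
  by_cases hcw : c • w = w
  · -- one place over `ℓ`: `ψ(w) = ψ((ℓ))` is real
    rw [hcw, Set.pair_eq_singleton, finprod_mem_singleton] at hprod
    rw [hcw, ← hprod]
    by_cases h2 : ℓ = 2
    · rw [htwo_val h2, map_mul, map_ofNat, map_intCast]
    · rw [hodd_val h2, map_mul, map_intCast, map_natCast]
  · -- two places: `ψ(w)·ψ(c w) = ψ((ℓ)) = ℓ` and `|ψ(w)| = |ψ(c w)|`
    rw [finprod_mem_pair (Ne.symm hcw)] at hprod
    have hcard := natCard_placesOver_eq_two_of_ne hK2 c hc hv hℓw hcw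
    have hval : idealPow K ψ (Ideal.span {(ℓ : 𝓞 K)}) = (ℓ : ℂ) := by
      by_cases h2 : ℓ = 2
      · rw [htwo_val h2, h2]
        have hnc : ((Ideal.span {(2 : ℤ)}).primesOver (𝓞 K)).ncard = 2 := by
          subst h2
          rw [show ((2 : ℤ)) = ((2 : ℕ) : ℤ) from rfl, primesOver_span_eq_primesOver_asIdeal hv, ← natCard_placesOver_eq_ncard]
          exact hcard
        have h8 := (Literature.NumberTheory.QuadraticFields.Quadratic.ncard_primesOver_two_eq_two_iff hK2).mp hnc
        have h2D : ¬ 2 ∣ (NumberField.discr K).natAbs * Ideal.absNorm 𝔪 := h2 ▸ hℓD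
        have hdD : NumberField.discr K ∣ (((NumberField.discr K).natAbs * Ideal.absNorm 𝔪 : ℕ) : ℤ) := by
          rw [Nat.cast_mul]; exact (Int.dvd_natAbs.mpr dvd_rfl).mul_right _
        have hJ : jacobiSym (NumberField.discr K) (((NumberField.discr K).natAbs * Ideal.absNorm 𝔪) ^ 2 + 2) = 1 :=
          jacobiSym_eq_one_of_mod_eight h8 hK.discr_neg (sq_add_two_mod_eight (Nat.two_dvd_ne_zero.mp h2D)) (by
            have e : ((((NumberField.discr K).natAbs * Ideal.absNorm 𝔪) ^ 2 + 2 : ℕ) : ℤ) - 2 =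
                (((NumberField.discr K).natAbs * Ideal.absNorm 𝔪 : ℕ) : ℤ) ^ 2 := by push_cast; ring
            rw [e]; exact dvd_pow hdD two_ne_zero)
        rw [hJ]; push_cast; ring
      · rw [hodd_val h2, (natCard_placesOver_eq_two_iff_jacobiSym hK2 hv h2).mp hcard]; push_cast; ring
    have hab : ψ w * ψ (c • w) = ((ℓ : ℝ) : ℂ) := by rw [← hprod, hval]; norm_cast
    have hn : ‖ψ w‖ ^ 2 = ‖ψ (c • w)‖ ^ 2 := by
      rw [norm_apply_sq_eq_absNorm σK hK2 h𝔪 hψ hwcop, norm_apply_sq_eq_absNorm σK hK2 h𝔪 hψ hcwcop, HeightOneSpectrum.absNorm_algEquiv_smul]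
    exact eq_conj_of_mul_eq_of_norm_sq_eq (Nat.cast_pos.mpr hℓ.pos) hab hn

end Main

end Summit.BirchSwinnertonDyer.BirchSwinnertonDyer.Theorems.SmallImageRttF1Bridge

end
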